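import Summits.AtomisticToContinuum.Crystallization.Theorems.ChargedEnergyGapRegistryRigidity
import HarnessLib

/-!
# Charged energy gap — lens-3 g67, «RegistryTail»: [VIR-fub] and [VIR-sum] PROVED — [CLS] ⟸ [DOM] alone

Cell `decomp-a2c`, seat lens-3, generation 67, part P-N⁗·c (over «RegistryRigidity» `…Theorems.ChargedEnergyGapRegistryRigidity`, itself an append
to node «StackingClass», critic row 1278; this file is an APPEND: same namespace, imports it).  ELEMENTARY·PROVED; complete (no placeholders); standard axioms.

WHAT IT DOES.  «RegistryRigidity» proved [CLS] ⟸ [DOM] ∧ [VIR-fub] ∧ [VIR-sum], leaving two summability licences: [VIR-fub]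
`BarlowVirialSummable` (the site-virial family `virialTermNN a h s m i₀ j₀` is summable over `ℤ³` for EVERY word `s`) and [VIR-sum]
`LayerDeltaSummable` (`j ↦ δ_j^⊥(a, h)` summable for all `a, h > 0`).  Both are proved here from ONE library fact,
`PeriodicConfiguration.summable_inv_pow_dist` (Epstein convergence, exponent `> 3`), applied to the SIMPLE HEXAGONAL LATTICE `ℤu + ℤv + ℤ(h e₃)`
= the Barlow stacking of the ZERO word `flatSeq` (`hexConfiguration` := `barlowPeriodicConfiguration flatSeq …`, period `1`):
* §V5 `summable_barlowStacking_of_punctured` (summability transfer `S ∖ {x} → ℤ³` through `barlowPos`, `summable_subtype_iff_indicator` +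
  `Summable.comp_injective barlowPos_injective`), ★ `summable_hex_inv_pow` (`t ↦ dist(x, hexPos t)⁻ⁿ` summable on `ℤ³`, `n > 3`, any `x`),
  the class-`t` lattice vector `hexVec` and majorant `majorNN = d⁻¹² + d⁻⁶` (★ `summable_majorNN`, base point `x = −t w`), the `ℤ³` layer-sum
  family `layerTermNN` (its layer slice IS `layerSumNN a h |k| t`, `tsum_layerTermNN`, by `rfl`), the scalar core `abs_ljD1_div_mul_sq_le`
  (`|V′(d)/d·c²| ≤ d⁻¹² + d⁻⁶` for `c² ≤ d²`), ★ `abs_layerTermNN_le`, ★ `summable_layerTermNN`, ★ `summable_layerSumNN` (`Summable.prod`),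
  ★★ `layerDeltaSummable_holds : LayerDeltaSummable` — [VIR-sum] PROVED;
* the LAYER-WISE SHEAR `shearEquiv` of `ℤ³` by `(i₀ − q_k, j₀ − q_k)`, `q_k = ⌊(L k − L m)/3⌋` (`registryShift`; `3w = u + v`), under which the
  site-virial family BECOMES the layer-sum family of class `r_k = (L k − L m) mod 3 ∈ {0,1,2}` (`registryClass`) at height `k − m`
  (★ `norm_barlowPos_shear_sub`, ★ `virialTermNN_shear`), bounded by the three class majorants (`heightShift`), whence
  ★★ `barlowVirialSummable_holds : BarlowVirialSummable` — [VIR-fub] PROVED (`Equiv.summable_iff`, `Summable.of_norm_bounded`);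
* NET: ★★ `layerVirialIdentity_holds : LayerVirialIdentity`, ★★ `registryRigidityOfDominance_holds : RegistryRigidityOfDominance` ([VIR-red]
  UNCONDITIONAL), ★★★ `barlowStressFreeClassification_of_layerDominance : LayerDominance → BarlowStressFreeClassification` —
  **[CLS] ⟸ [DOM]**: beneath the classification only the interval-arithmetic certificate `LayerDominance` (node «StackingClass» §C6) remains.
-/

noncomputable section

open scoped Classical
open Literature.MathematicalPhysics.StatisticalMechanics Literature.Geometry.DiscreteGeometry
open Summit.AtomisticToContinuum.Crystallization.Theses.PricedLinkCensus
open Summit.AtomisticToContinuum.Crystallization.Theorems.ChargedEnergyGapNegative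

namespace Summit.AtomisticToContinuum.Crystallization.Theorems.ChargedEnergyGapChartDial

/-! ## §V5 ★★ [VIR-fub] AND [VIR-sum] DISCHARGED: both summabilities follow from `PeriodicConfiguration.summable_inv_pow_dist` applied to
the SIMPLE HEXAGONAL lattice `ℤu + ℤv + ℤ(h e₃)` (the Barlow "stacking" of the ZERO word), after a layer-wise shear of `ℤ³` that absorbs the
Hägg letters into the registry class `r ∈ {0, 1, 2}`; hence [CLS] ⟸ [DOM] ALONE. -/

section Tail

variable {P : PeriodicConfiguration 3}

/-- SUMMABILITY TRANSFER `S ∖ {x} → ℤ³`: a family summable over the punctured stacking is summable over `ℤ³` through `barlowPos`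
(the value at a puncture index, if any, must vanish). -/
theorem summable_barlowStacking_of_punctured {a h : ℝ} (ha : 0 < a) (hh : 0 < h) (s : ℤ → ℤ) (x : E3) (F : E3 → ℝ)
    (hF : ∀ t : ℤ × ℤ × ℤ, barlowPos a h s t.1 t.2.1 t.2.2 = x → F x = 0)
    (hS : Summable fun w : {w : E3 // w ∈ barlowStacking a h s ∧ w ≠ x} => F w) :
    Summable fun t : ℤ × ℤ × ℤ => F (barlowPos a h s t.1 t.2.1 t.2.2) := by
  have h1 : Summable ({w : E3 | w ∈ barlowStacking a h s ∧ w ≠ x}.indicator F) :=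
    (summable_subtype_iff_indicator (s := {w : E3 | w ∈ barlowStacking a h s ∧ w ≠ x})).1 hS
  refine (h1.comp_injective (barlowPos_injective ha hh s)).congr fun t => ?_
  simp only [Function.comp]
  by_cases ht : barlowPos a h s t.1 t.2.1 t.2.2 = x
  · rw [ht, hF t ht, Set.indicator_of_notMem]
    simp
  · exact Set.indicator_of_mem (show barlowPos a h s t.1 t.2.1 t.2.2 ∈ {w : E3 | w ∈ barlowStacking a h s ∧ w ≠ x} from
      ⟨barlowPos_mem t.1 t.2.1 t.2.2, ht⟩) F

/-- The ZERO stacking word: all layers in registry — its "Barlow stacking" is the simple hexagonal lattice `ℤu + ℤv + ℤ(h e₃)`. -/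
def flatSeq : ℤ → ℤ := fun _ => 0

/-- `flatSeq_apply` (docstring added by the landing lane; see the module docstring). [formal bookkeeping] -/
@[simp] theorem flatSeq_apply (i : ℤ) : flatSeq i = 0 := rfl

/-- `haggLabel_flatSeq` (docstring added by the landing lane; see the module docstring). [formal bookkeeping] -/
@[simp] theorem haggLabel_flatSeq (k : ℤ) : haggLabel flatSeq k = 0 := by
  unfold haggLabel haggWindow
  simp

/-- Points of the hexagonal lattice: `barlowPos a h flatSeq k i j = i u + j v + k h e₃`. -/
theorem barlowPos_flatSeq (a h : ℝ) (k i j : ℤ) :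
    barlowPos a h flatSeq k i j = (i : ℝ) • triangularVec₁ a + (j : ℝ) • triangularVec₂ a + (k : ℝ) • layerNormal h := by
  unfold barlowPos
  simp

/-- THE SIMPLE HEXAGONAL LATTICE as a periodic configuration (period `1`, zero word). -/
def hexConfiguration {a h : ℝ} (ha : 0 < a) (hh : 0 < h) : PeriodicConfiguration 3 :=
  barlowPeriodicConfiguration flatSeq ha.ne' hh.ne' one_ne_zero fun _ => rfl

/-- `hexConfiguration_points` (docstring added by the landing lane; see the module docstring). [formal bookkeeping] -/
theorem hexConfiguration_points {a h : ℝ} (ha : 0 < a) (hh : 0 < h) :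
    (hexConfiguration ha hh).points = barlowStacking a h flatSeq :=
  barlowPeriodicConfiguration_points flatSeq ha.ne' hh.ne' one_ne_zero fun _ => rfl

/-- ★ EPSTEIN-TYPE SUMMABILITY ON `ℤ³`: `t ↦ dist(x, hexPos t)⁻ⁿ` is summable for `n > 3` and every base point `x`. -/
theorem summable_hex_inv_pow {a h : ℝ} (ha : 0 < a) (hh : 0 < h) {n : ℕ} (hn : 3 < n) (x : E3) :
    Summable fun t : ℤ × ℤ × ℤ => (dist x (barlowPos a h flatSeq t.1 t.2.1 t.2.2))⁻¹ ^ n := by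
  refine summable_barlowStacking_of_punctured ha hh flatSeq x (fun y => (dist x y)⁻¹ ^ n) (fun t _ => ?_) ?_
  · have hn0 : n ≠ 0 := by omega
    simp [hn0]
  · rw [← hexConfiguration_points ha hh]
    exact (hexConfiguration ha hh).summable_inv_pow_dist hn x

/-- The lattice vector `i u + j v + t w + k h e₃` of the `ℤ³` family `(k, i, j)` in registry class `t`. -/
def hexVec (a h : ℝ) (t : ℤ) (q : ℤ × ℤ × ℤ) : E3 :=
  (q.2.1 : ℝ) • triangularVec₁ a + (q.2.2 : ℝ) • triangularVec₂ a + (t : ℝ) • barlowOffset a + (q.1 : ℝ) • layerNormal h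

/-- THE MAJORANT `d⁻¹² + d⁻⁶`, `d = ‖hexVec‖`. -/
def majorNN (a h : ℝ) (t : ℤ) (q : ℤ × ℤ × ℤ) : ℝ :=
  (‖hexVec a h t q‖⁻¹) ^ 12 + (‖hexVec a h t q‖⁻¹) ^ 6

/-- `majorNN_nonneg` (docstring added by the landing lane; see the module docstring). [formal bookkeeping] -/
theorem majorNN_nonneg (a h : ℝ) (t : ℤ) (q : ℤ × ℤ × ℤ) : 0 ≤ majorNN a h t q := by
  unfold majorNN; positivity

/-- `‖hexVec‖` is the distance from `−t w` to the hexagonal lattice point. -/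
theorem dist_neg_offset_barlowPos_flatSeq (a h : ℝ) (t : ℤ) (q : ℤ × ℤ × ℤ) :
    dist (-((t : ℝ) • barlowOffset a)) (barlowPos a h flatSeq q.1 q.2.1 q.2.2) = ‖hexVec a h t q‖ := by
  rw [dist_eq_norm, ← norm_neg, barlowPos_flatSeq, hexVec]
  congr 1
  abel

/-- ★ The majorant is summable over `ℤ³` (two Epstein sums of the hexagonal lattice, exponents `12` and `6`). -/
theorem summable_majorNN {a h : ℝ} (ha : 0 < a) (hh : 0 < h) (t : ℤ) : Summable (majorNN a h t) := by
  have h12 := summable_hex_inv_pow ha hh (show 3 < 12 by norm_num) (-((t : ℝ) • barlowOffset a))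
  have h6 := summable_hex_inv_pow ha hh (show 3 < 6 by norm_num) (-((t : ℝ) • barlowOffset a))
  simp only [dist_neg_offset_barlowPos_flatSeq] at h12 h6
  exact h12.add h6

/-- The third coordinate of `hexVec`. -/
theorem hexVec_apply_two (a h : ℝ) (t : ℤ) (q : ℤ × ℤ × ℤ) : hexVec a h t q 2 = q.1 * h := by
  simp [hexVec, triangularVec₁, triangularVec₂, barlowOffset, layerNormal]

/-- The height enters the norm only through its square: replacing `k` by `|k|` does not change `‖hexVec‖`. -/
theorem norm_hexVec_natAbs (a h : ℝ) (t : ℤ) (q : ℤ × ℤ × ℤ) :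
    ‖(q.2.1 : ℝ) • triangularVec₁ a + (q.2.2 : ℝ) • triangularVec₂ a + (t : ℝ) • barlowOffset a + ((q.1.natAbs : ℕ) : ℝ) • layerNormal h‖ =
      ‖hexVec a h t q‖ := by
  have hn : (((q.1.natAbs : ℕ) : ℝ)) ^ 2 = ((q.1 : ℝ)) ^ 2 := by
    rw [Nat.cast_natAbs, Int.cast_abs, sq_abs]
  rw [EuclideanSpace.norm_eq, EuclideanSpace.norm_eq, hexVec]
  congr 1
  simp only [Fin.sum_univ_three, triangularVec₁, triangularVec₂, barlowOffset, layerNormal, PiLp.add_apply, PiLp.smul_apply, smul_eq_mul,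
    Real.norm_eq_abs, sq_abs]
  simp only [Matrix.cons_val_zero, Matrix.cons_val_one, Matrix.head_cons, Matrix.cons_val_two, Matrix.tail_cons, mul_zero, add_zero]
  have e3 : ((q.1.natAbs : ℕ) : ℝ) * h * (((q.1.natAbs : ℕ) : ℝ) * h) = ((q.1 : ℝ)) ^ 2 * h ^ 2 := by
    rw [← hn]; ring
  nlinarith [e3, hn]

/-- THE `ℤ³` LAYER-SUM FAMILY in registry class `t`: its layer-`k` slice sums to `layerSumNN a h |k| t` BY DEFINITION. -/
def layerTermNN (a h : ℝ) (t : ℤ) (q : ℤ × ℤ × ℤ) : ℝ :=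
  ljD1 ‖(q.2.1 : ℝ) • triangularVec₁ a + (q.2.2 : ℝ) • triangularVec₂ a + (t : ℝ) • barlowOffset a + ((q.1.natAbs : ℕ) : ℝ) • layerNormal h‖ /
      ‖(q.2.1 : ℝ) • triangularVec₁ a + (q.2.2 : ℝ) • triangularVec₂ a + (t : ℝ) • barlowOffset a + ((q.1.natAbs : ℕ) : ℝ) • layerNormal h‖ *
    (((q.1.natAbs : ℕ) : ℝ) * h) ^ 2

/-- `tsum_layerTermNN` (docstring added by the landing lane; see the module docstring). [formal bookkeeping] -/
theorem tsum_layerTermNN (a h : ℝ) (t k : ℤ) : ∑' p : ℤ × ℤ, layerTermNN a h t (k, p) = layerSumNN a h k.natAbs t := rfl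

/-- SCALAR CORE of every majorant here (cf. `summable_virial`): `|V′(d)/d · c²| ≤ d⁻¹² + d⁻⁶` for `c² ≤ d²`. -/
theorem abs_ljD1_div_mul_sq_le {d c : ℝ} (hd : 0 < d) (hc : c ^ 2 ≤ d ^ 2) : |ljD1 d / d * c ^ 2| ≤ d⁻¹ ^ 12 + d⁻¹ ^ 6 := by
  have hD : |ljD1 d| ≤ d⁻¹ ^ 13 + d⁻¹ ^ 7 := by
    unfold ljD1
    refine (abs_add_le _ _).trans ?_
    rw [abs_neg, abs_of_nonneg (by positivity), abs_of_nonneg (by positivity)]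
  rw [abs_mul, abs_div, abs_of_pos hd, abs_of_nonneg (sq_nonneg c)]
  have hdi : d⁻¹ * d = 1 := inv_mul_cancel₀ hd.ne'
  calc |ljD1 d| / d * c ^ 2 ≤ (d⁻¹ ^ 13 + d⁻¹ ^ 7) / d * d ^ 2 := by gcongr
    _ = (d⁻¹ ^ 12 + d⁻¹ ^ 6) * (d⁻¹ * d) * (d⁻¹ * d) := by rw [div_eq_mul_inv]; ring
    _ = d⁻¹ ^ 12 + d⁻¹ ^ 6 := by rw [hdi, mul_one, mul_one]

/-- ★ POINTWISE MAJORANT of the layer-sum family. -/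
theorem abs_layerTermNN_le (a h : ℝ) (t : ℤ) (q : ℤ × ℤ × ℤ) : |layerTermNN a h t q| ≤ majorNN a h t q := by
  unfold layerTermNN majorNN
  rw [norm_hexVec_natAbs]
  have hsq : (((q.1.natAbs : ℕ) : ℝ) * h) ^ 2 = (hexVec a h t q 2) ^ 2 := by
    rw [hexVec_apply_two, mul_pow, mul_pow, Nat.cast_natAbs, Int.cast_abs, sq_abs]
  rw [hsq]
  rcases eq_or_lt_of_le (norm_nonneg (hexVec a h t q)) with h0 | hpos
  · rw [← h0]
    simp
  · refine abs_ljD1_div_mul_sq_le hpos ?_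
    have h2 : |hexVec a h t q 2| ≤ ‖hexVec a h t q‖ := by
      have := PiLp.norm_apply_le (hexVec a h t q) 2
      rwa [Real.norm_eq_abs] at this
    rw [← sq_abs]
    exact pow_le_pow_left₀ (abs_nonneg _) h2 2

/-- ★ The layer-sum family is summable over `ℤ³` in every registry class. -/
theorem summable_layerTermNN {a h : ℝ} (ha : 0 < a) (hh : 0 < h) (t : ℤ) : Summable (layerTermNN a h t) :=
  (summable_majorNN ha hh t).of_norm_bounded fun q => by
    rw [Real.norm_eq_abs]; exact abs_layerTermNN_le a h t q

/-- ★ COROLLARY: `j ↦ layerSumNN a h j t` is summable (fibrewise sums of a summable `ℤ³` family, `Summable.prod`). -/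
theorem summable_layerSumNN {a h : ℝ} (ha : 0 < a) (hh : 0 < h) (t : ℤ) : Summable fun j : ℕ => layerSumNN a h j t := by
  have h1 : Summable fun k : ℤ => layerSumNN a h k.natAbs t :=
    ((summable_layerTermNN ha hh t).prod).congr fun k => tsum_layerTermNN a h t k
  exact (h1.comp_injective Nat.cast_injective).congr fun j => by simp

/-- ★★ **[VIR-sum] PROVED.** -/
theorem layerDeltaSummable_holds : LayerDeltaSummable := fun _ _ ha hh =>
  ((summable_layerSumNN ha hh 0).sub (summable_layerSumNN ha hh 1)).congr fun _ => rfl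

/-! ### [VIR-fub]: shear `ℤ³` layer-wise so that the Hägg letters become the registry class `r ∈ {0,1,2}` -/

/-- The in-layer translation `q = ⌊(L k − L m)/3⌋` absorbing the letters (`3w = u + v`). -/
def registryShift (s : ℤ → ℤ) (m k : ℤ) : ℤ := (haggLabel s k - haggLabel s m) / 3

/-- The registry class `r = (L k − L m) mod 3 ∈ {0, 1, 2}` of layer `k` relative to layer `m`. -/
def registryClass (s : ℤ → ℤ) (m k : ℤ) : ℤ := (haggLabel s k - haggLabel s m) % 3

/-- `registryClass_cases` (docstring added by the landing lane; see the module docstring). [formal bookkeeping] -/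
theorem registryClass_cases (s : ℤ → ℤ) (m k : ℤ) : registryClass s m k = 0 ∨ registryClass s m k = 1 ∨ registryClass s m k = 2 := by
  unfold registryClass; omega

/-- LAYER-WISE SHEAR of `ℤ³`: `(k, i, j) ↦ (k, i + c k, j + d k)` (a bijection). -/
def shearEquiv (c d : ℤ → ℤ) : ℤ × ℤ × ℤ ≃ ℤ × ℤ × ℤ where
  toFun x := (x.1, x.2.1 + c x.1, x.2.2 + d x.1)
  invFun x := (x.1, x.2.1 - c x.1, x.2.2 - d x.1)
  left_inv x := by simp
  right_inv x := by simp

/-- HEIGHT SHIFT of `ℤ³`: `(k, p) ↦ (k − m, p)`. -/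
def heightShift (m : ℤ) : ℤ × ℤ × ℤ ≃ ℤ × ℤ × ℤ where
  toFun x := (x.1 - m, x.2)
  invFun x := (x.1 + m, x.2)
  left_inv x := by simp
  right_inv x := by simp

/-- ★ THE SHEARED BOND VECTOR: after the in-layer translation by `(i₀ − q, j₀ − q)` the bond from the site `barlowPos m i₀ j₀` to layer `k`
is the class-`r` hexagonal vector at height `|k − m|` (in norm). -/
theorem norm_barlowPos_shear_sub (a h : ℝ) (s : ℤ → ℤ) (m i₀ j₀ : ℤ) (x : ℤ × ℤ × ℤ) :
    ‖barlowPos a h s x.1 (x.2.1 + (i₀ - registryShift s m x.1)) (x.2.2 + (j₀ - registryShift s m x.1)) - barlowPos a h s m i₀ j₀‖ =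
      ‖(x.2.1 : ℝ) • triangularVec₁ a + (x.2.2 : ℝ) • triangularVec₂ a + (registryClass s m x.1 : ℝ) • barlowOffset a +
        (((x.1 - m).natAbs : ℕ) : ℝ) • layerNormal h‖ := by
  have hΔ : (haggLabel s x.1 : ℝ) = haggLabel s m + 3 * registryShift s m x.1 + registryClass s m x.1 := by
    have h2 : (haggLabel s x.1 : ℤ) = haggLabel s m + 3 * registryShift s m x.1 + registryClass s m x.1 := by
      unfold registryShift registryClass; omega
    exact_mod_cast h2
  have hn : (((x.1 - m).natAbs : ℕ) : ℝ) ^ 2 = ((x.1 : ℝ) - m) ^ 2 := by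
    rw [Nat.cast_natAbs, Int.cast_abs, sq_abs]; push_cast; ring
  rw [EuclideanSpace.norm_eq, EuclideanSpace.norm_eq]
  congr 1
  simp only [Fin.sum_univ_three, Int.cast_add, Int.cast_sub, triangularVec₁, triangularVec₂, barlowOffset, layerNormal, PiLp.add_apply,
    PiLp.sub_apply, PiLp.smul_apply, smul_eq_mul, Real.norm_eq_abs, sq_abs, barlowPos_apply_zero, barlowPos_apply_one, barlowPos_apply_two]
  simp only [Matrix.cons_val_zero, Matrix.cons_val_one, Matrix.head_cons, Matrix.cons_val_two, Matrix.tail_cons, mul_zero, add_zero]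
  rw [hΔ]
  have e3 : (((x.1 - m).natAbs : ℕ) : ℝ) * h * ((((x.1 - m).natAbs : ℕ) : ℝ) * h) = ((x.1 : ℝ) - m) ^ 2 * h ^ 2 := by
    rw [← hn]; ring
  nlinarith [e3, hn]

/-- ★ THE SHEARED FAMILY IS THE LAYER-SUM FAMILY: `virialTermNN ∘ shear = layerTermNN (class r_k) (k − m, ·)` pointwise. -/
theorem virialTermNN_shear (a h : ℝ) (s : ℤ → ℤ) (m i₀ j₀ : ℤ) (x : ℤ × ℤ × ℤ) :
    virialTermNN a h s m i₀ j₀ (x.1, x.2.1 + (i₀ - registryShift s m x.1), x.2.2 + (j₀ - registryShift s m x.1)) =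
      layerTermNN a h (registryClass s m x.1) (x.1 - m, x.2) := by
  have hn : (((x.1 - m).natAbs : ℕ) : ℝ) ^ 2 = ((x.1 : ℝ) - m) ^ 2 := by
    rw [Nat.cast_natAbs, Int.cast_abs, sq_abs]; push_cast; ring
  have fac : (((x.1 : ℝ) - m) * h) * (((x.1 : ℝ) - m) * h) = ((((x.1 - m).natAbs : ℕ) : ℝ) * h) ^ 2 := by
    rw [mul_pow, hn]; ring
  unfold virialTermNN layerTermNN
  simp only
  rw [norm_barlowPos_shear_sub, fac]

/-- ★★ **[VIR-fub] PROVED**: shear `ℤ³` (`Equiv.summable_iff`), bound the sheared family by the three class majorants at height `k − m`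
(`abs_layerTermNN_le`, `registryClass_cases`), each summable (`summable_majorNN` moved by `heightShift`). -/
theorem barlowVirialSummable_holds : BarlowVirialSummable := by
  intro a h s m i₀ j₀ ha hh
  have hM : ∀ t : ℤ, Summable fun x : ℤ × ℤ × ℤ => majorNN a h t (x.1 - m, x.2) := fun t =>
    (heightShift m).summable_iff.2 (summable_majorNN ha hh t)
  rw [← (shearEquiv (fun k => i₀ - registryShift s m k) (fun k => j₀ - registryShift s m k)).summable_iff]
  refine ((hM 0).add ((hM 1).add (hM 2))).of_norm_bounded fun x => ?_
  rw [Real.norm_eq_abs]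
  show |virialTermNN a h s m i₀ j₀ (x.1, x.2.1 + (i₀ - registryShift s m x.1), x.2.2 + (j₀ - registryShift s m x.1))| ≤ _
  rw [virialTermNN_shear]
  have hb := abs_layerTermNN_le a h (registryClass s m x.1) (x.1 - m, x.2)
  have h0 := majorNN_nonneg a h 0 (x.1 - m, x.2)
  have h1 := majorNN_nonneg a h 1 (x.1 - m, x.2)
  have h2 := majorNN_nonneg a h 2 (x.1 - m, x.2)
  rcases registryClass_cases s m x.1 with hr | hr | hr <;> rw [hr] at hb ⊢ <;> linarith

/-! ### Net: [CLS] ⟸ [DOM] alone -/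

/-- ★★ [VIR] UNCONDITIONAL: the layer-sum identity of the normal–normal site virial holds for every rigid Barlow presentation. -/
theorem layerVirialIdentity_holds : LayerVirialIdentity :=
  layerVirialIdentity_of_summable barlowVirialSummable_holds layerDeltaSummable_holds

/-- ★★ [VIR-red] UNCONDITIONAL: [DOM] ⟹ [CLS-an]. -/
theorem registryRigidityOfDominance_holds : RegistryRigidityOfDominance :=
  registryRigidityOfDominance_of_identity layerVirialIdentity_holds layerDeltaSummable_holds

/-- ★★ [CLS-an] ⟸ [DOM]. -/
theorem barlowRegistryRigidity_of_layerDominance (hD : LayerDominance) : BarlowRegistryRigidity :=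
  registryRigidityOfDominance_holds hD

/-- ★★★ **[CLS] ⟸ [DOM]**: the Barlow stress-free classification (`IsBarlowImage ∧ IsSiteStressFree ⟹ fcc ∨ hcp`) follows from the ONE
interval-arithmetic certificate `LayerDominance` on the window. -/
theorem barlowStressFreeClassification_of_layerDominance (hD : LayerDominance) : BarlowStressFreeClassification :=
  barlowStressFreeClassification_of_dominance hD registryRigidityOfDominance_holds

end Tail

end Summit.AtomisticToContinuum.Crystallization.Theorems.ChargedEnergyGapChartDial
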